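import Summits.QuantumFields.BalabanUV.T4Continuum.Support.BlockAverageLoopLogPrep
import Literature.MathematicalPhysics.QuantumFieldTheory.Balaban1983to89.T4TermwiseBCH

/-!
# T⁴ programme, node NE3 — the kinematic refinement lemma, leaf R1e (file 2/3): THE LOOP-LOG PREDICTION
# (first-moment law) for the exponent of Bałaban's average (42), core form in a normed algebra

NE3 formalisation swarm of the cell `pub-balaban`, crew seat `b2b-balaban-t4-ne3-formalise-leaf-08` (row S4e of
`t4/formal/NE3/LEAVES.md`; owner skeleton `t4/b2b-balaban-t4-ne3-p1/SKELETON-NE3-P1.md` v1.1, §3 leaf R1e «loop-log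
prediction … by non-abelian Stokes over loops of area ≤ dL²»).

CONTEXT.  The owner's re-cut of the refinement hypothesis (H2) of NE3(A) (`Support/MinimalActionRefine`, shape
`SmoothRefine`) asks for a KINEMATIC lemma: a slowly varying small field on the `η`-lattice is the exact block average
(42) of a slowly varying small field on the `η/L`-lattice.  Its plan (skeleton §2 ¶3): R1 an approximate covariant
refinement whose straight-line transporters are PRE-COMPENSATED by the first moment of the loop fluxes of (42), then R2
an exact chain-end correction (`Support/ChainEndContraction`, leaf R2a, in the tree).

THIS FILE (2/3) = the analytic core, for configurations with values in `{‖u‖ ≤ 1, ‖u⁻¹‖ ≤ 1}` of a complete normed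
`ℂ`-algebra (the generality of the tree's `B7Prop1Explicit`), over the tree's `Wcx`∕`Xavg`∕`bavg` (42), the axial
gauge `axialFn`∕`gaugeAct` of B5 (1.7), the linearisation `walk_linear`∕`bond_log`∕`norm_mlog_sub_le` of B7 pp. 24–25,
and file 1's staircase Stokes identity and first moment.  `plaqLog V κ m x = log V(∂p_{x; m, κ})` is the plaquette
logarithm in the orientation met by the loops of a `κ`-bond (`plaqWord m κ`; `0` for `m = κ`);
**`Xfirst L V q κ = (L(L−1)/2) • Σ_m plaqLog V κ m q`** is THE FIRST-MOMENT EXPONENT `X¹_c` of `c = ⟨q, q + Le_κ⟩`.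
**`norm_Xavg_sub_Xfirst_le`** — THE LOOP-LOG PREDICTION: if `‖V(∂p) − 1‖ ≤ a` at every unit plaquette (B7 (44)) with
`512(d+1)(d+4)L²a ≤ 1` and the plaquette logarithms have covariant forward differences `≤ g` along every bond, then
`‖X_c − X¹_c‖ ≤ 20 d L² θ² + d(d+1)L³ g`, `θ = 8(d+1)(d+4)L²a`, and `‖X_c‖ ≤ 4θ`.  Proof: axial gauge at `q` (bonds
within `ℓ¹`-distance `n` of `q` are within `na` of `1`: the tree's `axial_bond_bound`); `log` of each loop variable =
contour sum + `17θ²` (`loop_log_linear`, the step «(47) + (26)–(27)» of the tree's `side_estimate`); contour sum =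
staircase Stokes sum of `A(∂p)` over `L·Σ_{m≠κ} r_m ≤ dL²` plaquettes (file 1); each `A(∂p)` = plaquette logarithm
+ `16a′² + 4a²` (`norm_asum_plaqWord_sub_plaqLog_le`), which drifts by `≤ g + 4Da²` per bond (`norm_step_le_of_covStep`)
over `≤ D = (d+1)L` bonds back to the corner; the gauge is trivial AT `q`; the block average of the swept counts is
the first moment `L(L−1)/2`.

HONEST FRAMING.  Kinematics of (42) (finite-T⁴ rung (B)+1 of the cell's ladder); OURS and elementary (B7 prints the
ZEROTH-order law, Prop. 1 (51); the first-moment law with a flux-gradient hypothesis is not printed); nothing here is an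
estimate on a minimiser; no conditional of the cell (`BetaPertH`, (B), (B^μ)) is used or hidden; nothing bears on
infinite volume, a mass gap, or the Clay problem; **NE3 is NOT proved** (this is leaf R1e of the UNPROVED kinematic
lemma `SmoothRefine`; leaves R1a–d and the glue R0 remain open; R2a is the owner's `ChainEndContraction`).  ABSOLUTE
RULE of the cell kept: no printed sentence is a hypothesis of any declaration; no `sorry`, no axioms beyond Mathlib's.
PLACEMENT (human rule 2026-08-19): cell work under `Summits/QuantumFields/BalabanUV/`; imports file 1
(`Support/BlockAverageLoopLogPrep`) and the tree's `T4TermwiseBCH` (for `norm_units_conj_le`) only; moves nothing.  Records: `t4/formal/NE3/LEAVES.md` row S4e; CLAIMS.log «CLAIM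
NE3-S4e» (l.7127) of the cell `pub-balaban`.
-/

set_option autoImplicit false

open scoped BigOperators
open NormedSpace Finset

namespace Summit.QuantumFields.BalabanUV.T4Continuum.BlockAverageLoopLogCore

open Literature.MathematicalPhysics.QuantumFieldTheory.Balaban1983to89
open B7Prop1Explicit B7Prop2Explicit MatrixLog
open T4TermwiseBCH (norm_units_conj_le)
open BlockAverageLoopLogPrep

noncomputable section

variable {d : ℕ}

/-! ## §4 The loop-log prediction: the exponent of (42) to first order in the plaquette fluxes at the corner -/

section Core

variable {𝔸 : Type*} [NormedRing 𝔸] [NormOneClass 𝔸] [NormedAlgebra ℂ 𝔸] [CompleteSpace 𝔸]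

/-- The plaquette logarithm `log V(∂p)` of the plaquette at `x` spanned by `e_m, e_κ`, in the ORIENTATION MET BY THE
LOOPS OF (42) of a bond in direction `κ` (the word `plaqWord m κ`: first `e_m`, then `e_κ`); for `m = κ` it is `0`.
In the tree's flux vocabulary: `= flux V (x; m<κ)` for `m < κ` and `= −flux V (x; κ<m)` for `κ < m` (§5). [folklore] -/
def plaqLog (V : Site d → Fin d → 𝔸ˣ) (κ m : Fin d) (x : Site d) : 𝔸 :=
  mlog ((hol V x (plaqWord m κ) : 𝔸ˣ) : 𝔸)

/-- **THE FIRST-MOMENT EXPONENT** `X¹_c := (L(L−1)/2) · Σ_m log V(∂p_{q; m, κ})` of the bond `c = ⟨q, q + Le_κ⟩` of the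
`L`-lattice: the prediction for the exponent `X_c` of Bałaban's average (42) `V̄_c = exp(X_c) V(Γ_c)` to first order
in the plaquette variables, all read at the corner `q` — `L(L−1)/2 = Σ_{x ∈ B(c₋)} L^{−d} · (L · (x − c₋)_m)` is the
number of plaquettes of the plane `{m, κ}` swept by the loop `Γ_{c,x} ∪ (−Γ_c)`, averaged over the block. OURS (the
zeroth-order law `|V̄(∂p′) − 1| ≤ L²α₀ + …` is B7 Prop. 1; this first-moment law is not printed). [folklore] -/
def Xfirst (L : ℕ) (V : Site d → Fin d → 𝔸ˣ) (q : Site d) (κ : Fin d) : 𝔸 :=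
  ((L : ℝ) * ((L : ℝ) - 1) / 2) • ∑ m : Fin d, plaqLog V κ m q

omit [NormedAlgebra ℂ 𝔸] [CompleteSpace 𝔸] in
/-- `‖w X w⁻¹ − X‖ ≤ 2 ‖w − 1‖ ‖X‖` for `w` with `‖w‖, ‖w⁻¹‖ ≤ 1` (`w X w⁻¹ − X = (w − 1) X w⁻¹ + X (w⁻¹ − 1)` and
`‖w⁻¹ − 1‖ ≤ ‖w − 1‖`). [folklore] -/
theorem norm_units_conj_sub_self_le {w : 𝔸ˣ} (hw : w ∈ U1 𝔸) (X : 𝔸) :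
    ‖(w : 𝔸) * X * ((w⁻¹ : 𝔸ˣ) : 𝔸) - X‖ ≤ 2 * ‖(w : 𝔸) - 1‖ * ‖X‖ := by
  have hid : (w : 𝔸) * X * ((w⁻¹ : 𝔸ˣ) : 𝔸) - X
      = ((w : 𝔸) - 1) * X * ((w⁻¹ : 𝔸ˣ) : 𝔸) + X * (((w⁻¹ : 𝔸ˣ) : 𝔸) - 1) := by
    noncomm_ring
  rw [hid]
  have hi := norm_inv_sub_one_le hw
  calc _ ≤ ‖((w : 𝔸) - 1) * X * ((w⁻¹ : 𝔸ˣ) : 𝔸)‖ + ‖X * (((w⁻¹ : 𝔸ˣ) : 𝔸) - 1)‖ := norm_add_le _ _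
    _ ≤ ‖(w : 𝔸) - 1‖ * ‖X‖ * ‖((w⁻¹ : 𝔸ˣ) : 𝔸)‖ + ‖X‖ * ‖((w⁻¹ : 𝔸ˣ) : 𝔸) - 1‖ :=
        add_le_add ((norm_mul_le _ _).trans (mul_le_mul_of_nonneg_right (norm_mul_le _ _) (norm_nonneg _)))
          (norm_mul_le _ _)
    _ ≤ ‖(w : 𝔸) - 1‖ * ‖X‖ * 1 + ‖X‖ * ‖(w : 𝔸) - 1‖ := by gcongr; exact hw.2
    _ = 2 * ‖(w : 𝔸) - 1‖ * ‖X‖ := by ring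

omit [NormOneClass 𝔸] [NormedAlgebra ℂ 𝔸] [CompleteSpace 𝔸] in
/-- The plaquette words are closed, so in a gauge-transformed configuration the plaquette variable is the conjugate
by `u` at the corner ((8)/(45)). [cite: Balaban1985Averaging, (8) p.18] -/
theorem hol_plaqWord_gaugeAct (u : Site d → 𝔸ˣ) (V : Site d → Fin d → 𝔸ˣ) (x : Site d) (m κ : Fin d) :
    hol (gaugeAct u V) x (plaqWord m κ) = u x * hol V x (plaqWord m κ) * (u x)⁻¹ :=
  hol_gaugeAct_closed u V x _ (disp_plaqWord m κ)

omit [NormOneClass 𝔸] in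
/-- **`log` of one loop variable of (42) versus its abelian contour sum** (the step "(47) for the contours
`Γ_{c,x} ∪ (−Γ_c)` and the logarithm (26)–(27)" of the tree's `side_estimate`, isolated): in a configuration `V₀` whose
bond variables within `ℓ¹`-distance `R` of `q` are `exp A_b`, `‖A_b‖ ≤ a′`, with `(2dL + 2L)a′ ≤ θ ≤ 1/64` and the loop
inside the region, `‖log W‖ ≤ 4θ` and `‖log W − A(Γ_{c,x} ∪ (−Γ_c))‖ ≤ 17θ²` for `W = V₀(Γ_{c,x})V₀(c)⁻¹`.
[cite: Balaban1985Averaging, p.25 (displays before (47))] -/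
theorem loop_log_linear (V₀ : Site d → Fin d → 𝔸ˣ) (A : Site d → Fin d → 𝔸) (q : Site d) (R : ℕ) {a' θ : ℝ}
    (ha' : 0 ≤ a') (hVA : ∀ x κ, l1 (x - q) ≤ R → ((V₀ x κ : 𝔸ˣ) : 𝔸) = exp (A x κ) ∧ ‖A x κ‖ ≤ a')
    (L : ℕ) (κ : Fin d) (hR : 2 * (d * L) + L + L ≤ R) (hθ : ((2 * (d * L) + L + L : ℕ) : ℝ) * a' ≤ θ)
    (hθ0 : 0 ≤ θ) (hθ1 : θ ≤ 1 / 64) (r : Fin d → Fin L) :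
    ‖mlog ((Wcx L V₀ q κ (boxVec L r) : 𝔸ˣ) : 𝔸)‖ ≤ 4 * θ ∧
      ‖mlog ((Wcx L V₀ q κ (boxVec L r) : 𝔸ˣ) : 𝔸)
          - asum A q (gammaWord L κ (boxVec L r) ++ seg κ (-(L : ℤ)))‖ ≤ 17 * θ ^ 2 := by
  -- adapted from the tree's `B7Prop1Explicit.side_estimate` (the internal step `hloop`)
  have hl10 : l1 (q - q) = 0 := by simp [l1]
  have hlen : (gammaWord L κ (boxVec L r) ++ seg κ (-(L : ℤ))).length ≤ 2 * (d * L) + L + L := by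
    rw [List.length_append, length_gammaWord, length_seg]
    have := l1_boxVec_le L r
    simp only [Int.natAbs_neg, Int.natAbs_natCast]
    omega
  obtain ⟨h1, h2⟩ := walk_linear V₀ A q R ha' hVA (gammaWord L κ (boxVec L r) ++ seg κ (-(L : ℤ))) q
    (by rw [hl10]; omega)
  rw [← Wcx_eq_hol_loop] at h1 h2
  have hna : ((gammaWord L κ (boxVec L r) ++ seg κ (-(L : ℤ))).length : ℝ) * a' ≤ θ :=
    (mul_le_mul_of_nonneg_right (by exact_mod_cast hlen) ha').trans hθ
  have hW : ‖((Wcx L V₀ q κ (boxVec L r) : 𝔸ˣ) : 𝔸) - 1‖ ≤ 2 * θ :=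
    h1.trans (exp_sub_one_le_of_le hna hθ0 hθ1)
  have hW' : ‖((Wcx L V₀ q κ (boxVec L r) : 𝔸ˣ) : 𝔸) - 1‖ ≤ 1 / 2 := hW.trans (by linarith)
  refine ⟨(MatrixLog.norm_mlog_le_two_mul hW').trans (by linarith), ?_⟩
  have h3 := norm_mlog_sub_le hW'
  have h4 : expRem (2 * ‖((Wcx L V₀ q κ (boxVec L r) : 𝔸ˣ) : 𝔸) - 1‖) ≤ 16 * θ ^ 2 :=
    (expRem_mono (by positivity) (by linarith)).trans (expRem4_le hθ0 hθ1)
  have h5 := expRem_le_sq_of_le (by positivity) hna hθ0 hθ1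
  calc _ = ‖(mlog ((Wcx L V₀ q κ (boxVec L r) : 𝔸ˣ) : 𝔸) - (((Wcx L V₀ q κ (boxVec L r) : 𝔸ˣ) : 𝔸) - 1))
          + ((((Wcx L V₀ q κ (boxVec L r) : 𝔸ˣ) : 𝔸) - 1)
            - asum A q (gammaWord L κ (boxVec L r) ++ seg κ (-(L : ℤ))))‖ := by rw [sub_add_sub_cancel]
    _ ≤ _ := norm_add_le _ _
    _ ≤ 16 * θ ^ 2 + θ ^ 2 := add_le_add (h3.trans h4) (h2.trans h5)
    _ = 17 * θ ^ 2 := by ring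

omit [NormOneClass 𝔸] in
/-- **The abelian plaquette functional versus the plaquette logarithm**: in a configuration `V₀` whose bond variables
within `ℓ¹`-distance `R` of `q` are `exp A_b`, `‖A_b‖ ≤ a′ ≤ 1/4`, and whose plaquette variable at `x` (within the
region) is within `a ≤ 1/2` of `1`: `‖A(∂p) − log V₀(∂p)‖ ≤ 16a′² + 4a²` ((49): `|V₀(∂p) − 1 − A(∂p)| ≤ ρ(4a′)`, and
(26)–(27): `|log W − (W − 1)| ≤ ρ(2|W − 1|)`). [cite: Balaban1985Averaging, (49) p.25, (26)–(27) p.21] -/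
theorem norm_asum_plaqWord_sub_plaqLog_le (V₀ : Site d → Fin d → 𝔸ˣ) (A : Site d → Fin d → 𝔸) (q : Site d)
    (R : ℕ) {a' a : ℝ} (ha' : 0 ≤ a') (ha'4 : 4 * a' ≤ 1)
    (hVA : ∀ x κ, l1 (x - q) ≤ R → ((V₀ x κ : 𝔸ˣ) : 𝔸) = exp (A x κ) ∧ ‖A x κ‖ ≤ a')
    (κ m : Fin d) (x : Site d) (hx : l1 (x - q) + 4 ≤ R)
    (hpx : ‖((hol V₀ x (plaqWord m κ) : 𝔸ˣ) : 𝔸) - 1‖ ≤ a) (ha2 : a ≤ 1 / 2) :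
    ‖asum A x (plaqWord m κ) - plaqLog V₀ κ m x‖ ≤ 16 * a' ^ 2 + 4 * a ^ 2 := by
  have hfit : l1 (x - q) + (plaqWord m κ).length ≤ R := by
    have h4 : (plaqWord m κ).length = 4 := by simp [plaqWord]
    rw [h4]; exact hx
  obtain ⟨-, h2⟩ := walk_linear V₀ A q R ha' hVA (plaqWord m κ) x hfit
  have hl4 : ((plaqWord m κ).length : ℝ) = 4 := by simp [plaqWord]
  rw [hl4] at h2
  have h16 : expRem (4 * a') ≤ 16 * a' ^ 2 := by
    have := expRem_le_sq (by positivity : 0 ≤ 4 * a') ha'4; nlinarith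
  have ha0 : 0 ≤ a := (norm_nonneg _).trans hpx
  have h3 := norm_mlog_sub_le (hpx.trans ha2)
  have h4 : expRem (2 * ‖((hol V₀ x (plaqWord m κ) : 𝔸ˣ) : 𝔸) - 1‖) ≤ 4 * a ^ 2 := by
    refine (expRem_mono (by positivity) (by linarith :
      2 * ‖((hol V₀ x (plaqWord m κ) : 𝔸ˣ) : 𝔸) - 1‖ ≤ 2 * a)).trans ?_
    have := expRem_le_sq (by positivity : 0 ≤ 2 * a) (by linarith); nlinarith
  unfold plaqLog
  calc _ = ‖-((((hol V₀ x (plaqWord m κ) : 𝔸ˣ) : 𝔸) - 1 - asum A x (plaqWord m κ))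
            + (mlog ((hol V₀ x (plaqWord m κ) : 𝔸ˣ) : 𝔸) - (((hol V₀ x (plaqWord m κ) : 𝔸ˣ) : 𝔸) - 1)))‖ := by
          congr 1; abel
    _ ≤ ‖(((hol V₀ x (plaqWord m κ) : 𝔸ˣ) : 𝔸) - 1 - asum A x (plaqWord m κ))‖
          + ‖mlog ((hol V₀ x (plaqWord m κ) : 𝔸ˣ) : 𝔸) - (((hol V₀ x (plaqWord m κ) : 𝔸ˣ) : 𝔸) - 1)‖ := by
          rw [norm_neg]; exact norm_add_le _ _
    _ ≤ 16 * a' ^ 2 + 4 * a ^ 2 := add_le_add (h2.trans h16) (h3.trans h4)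

omit [NormedAlgebra ℂ 𝔸] [CompleteSpace 𝔸] in
/-- **One covariant step of a plaquette function**: if `‖V(b) G(x + e_μ) V(b)⁻¹ − G(x)‖ ≤ g` (covariant forward
difference), `‖V(b) − 1‖ ≤ β` and `‖G(x + e_μ)‖ ≤ φ`, then the plain difference obeys
`‖G(x + e_μ) − G(x)‖ ≤ g + 2βφ`. [folklore] -/
theorem norm_step_le_of_covStep {w : 𝔸ˣ} (hw : w ∈ U1 𝔸) {G₁ G₀ : 𝔸} {g β φ : ℝ}
    (hcov : ‖(w : 𝔸) * G₁ * ((w⁻¹ : 𝔸ˣ) : 𝔸) - G₀‖ ≤ g) (hβ : ‖(w : 𝔸) - 1‖ ≤ β) (hφ : ‖G₁‖ ≤ φ) :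
    ‖G₁ - G₀‖ ≤ g + 2 * β * φ := by
  have hβ0 : 0 ≤ β := (norm_nonneg _).trans hβ
  have h1 : ‖(w : 𝔸) * G₁ * ((w⁻¹ : 𝔸ˣ) : 𝔸) - G₁‖ ≤ 2 * β * φ :=
    (norm_units_conj_sub_self_le hw _).trans (by gcongr)
  calc ‖G₁ - G₀‖ = ‖((w : 𝔸) * G₁ * ((w⁻¹ : 𝔸ˣ) : 𝔸) - G₀) - ((w : 𝔸) * G₁ * ((w⁻¹ : 𝔸ˣ) : 𝔸) - G₁)‖ := by
        rw [sub_sub_sub_cancel_left]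
    _ ≤ _ := norm_sub_le _ _
    _ ≤ g + 2 * β * φ := add_le_add hcov h1

omit [NormOneClass 𝔸] [CompleteSpace 𝔸] in
/-- **The block average of the first-moment main terms is `X¹_c`**: `Σ_r L^{−d} Σ_m (r_m L) • Φ m =
(L(L−1)/2) • Σ_m Φ m` (§2). [folklore] -/
theorem avg_stairMain_eq (L : ℕ) (hL : 1 ≤ L) (Φ : Fin d → 𝔸) :
    ∑ r : Fin d → Fin L, ((L : ℝ) ^ d)⁻¹ • stairMain L (fun m => (r m : ℕ)) Φ (List.finRange d).reverse
      = ((L : ℝ) * ((L : ℝ) - 1) / 2) • ∑ m : Fin d, Φ m := by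
  simp_rw [stairMain_finRange_reverse, Finset.smul_sum, ← mul_smul]
  rw [Finset.sum_comm]
  simp_rw [← Finset.sum_smul, avg_mul_coord_eq L hL]

/-- **THE LOOP-LOG PREDICTION (first-moment law of (42)), core form.**  Let `V` take values in
`{‖u‖ ≤ 1, ‖u⁻¹‖ ≤ 1}`, satisfy (44) `‖V(∂p) − 1‖ ≤ a` at every unit plaquette with `512(d+1)(d+4)L²a ≤ 1`, and let
the plaquette logarithms met by the loops of the bond `c = ⟨q, q + Le_κ⟩` have covariant forward differences
`‖V(b) log V(∂p_{x+e_μ}) V(b)⁻¹ − log V(∂p_x)‖ ≤ g` along every bond `b = ⟨x, x + e_μ⟩`.  Then the exponent `X_c` of the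
average (42) obeys `‖X_c − X¹_c‖ ≤ 20 d L² θ² + d(d+1)L³ g`, `θ = 8(d+1)(d+4)L²a`, and `‖X_c‖ ≤ 4θ` (proof outline in
the module header).  OURS; elementary; no minimiser, no variational problem; NE3 is NOT proved by it. [folklore] -/
theorem norm_Xavg_sub_Xfirst_le (L : ℕ) (hL : 1 ≤ L) (V : Site d → Fin d → 𝔸ˣ) (hV : ∀ x κ, V x κ ∈ U1 𝔸)
    {a g : ℝ} (ha : 0 ≤ a) (hg : 0 ≤ g) (hsmall : 512 * (d + 1) * (d + 4) * (L : ℝ) ^ 2 * a ≤ 1)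
    (h44 : ∀ (x : Site d) (μ ν : Fin d), μ ≠ ν → ‖((hol V x (plaqWord μ ν) : 𝔸ˣ) : 𝔸) - 1‖ ≤ a)
    (q : Site d) (κ : Fin d)
    (hgrad : ∀ (x : Site d) (μ m : Fin d),
      ‖(V x μ : 𝔸) * plaqLog V κ m (x + e μ) * ((V x μ)⁻¹ : 𝔸ˣ) - plaqLog V κ m x‖ ≤ g) :
    ‖Xavg L V q κ - Xfirst L V q κ‖
        ≤ 20 * d * (L : ℝ) ^ 2 * (8 * (d + 1) * (d + 4) * (L : ℝ) ^ 2 * a) ^ 2 + d * (d + 1) * (L : ℝ) ^ 3 * g ∧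
      ‖Xavg L V q κ‖ ≤ 4 * (8 * (d + 1) * (d + 4) * (L : ℝ) ^ 2 * a) := by
  have hd : 1 ≤ d := κ.pos
  -- the constants of the tree's `prop1_core`
  set R : ℕ := (2 * d + 4) * L + 4 with hRdef
  set a' : ℝ := 4 * (d + 4) * L * a with ha'def
  set θ : ℝ := 8 * (d + 1) * (d + 4) * (L : ℝ) ^ 2 * a with hθdef
  set D : ℕ := (d + 1) * L with hDdef
  have hLr : (1 : ℝ) ≤ L := by exact_mod_cast hL
  have hdr : (1 : ℝ) ≤ d := by exact_mod_cast hd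
  have ha' : 0 ≤ a' := by positivity
  have hθ0 : 0 ≤ θ := by positivity
  have hθ1 : θ ≤ 1 / 64 := by linarith [show 64 * θ = 512 * (d + 1) * (d + 4) * (L : ℝ) ^ 2 * a by rw [hθdef]; ring]
  have haθ : 4 * a' ≤ θ := by
    have e1 : θ - 4 * a' = 8 * ((d : ℝ) + 4) * L * a * ((d + 1) * L - 2) := by rw [hθdef, ha'def]; ring
    have e2 : 0 ≤ 8 * ((d : ℝ) + 4) * L * a * ((d + 1) * L - 2) :=
      mul_nonneg (by positivity) (by nlinarith [mul_nonneg (sub_nonneg.mpr hdr) (by positivity : (0 : ℝ) ≤ L)])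
    linarith
  have ha'1 : a' ≤ 1 := by linarith
  have haa' : a ≤ a' := by
    have e1 : a' - a = a * (4 * ((d : ℝ) + 4) * L - 1) := by rw [ha'def]; ring
    have e2 : 0 ≤ a * (4 * ((d : ℝ) + 4) * L - 1) := mul_nonneg ha (by nlinarith)
    linarith
  have ha2 : 2 * a ≤ θ := by linarith
  have hahalf : a ≤ 1 / 2 := by linarith
  have hRa : ((R : ℕ) : ℝ) * a ≤ a' / 2 := by
    have e1 : a' / 2 - ((R : ℕ) : ℝ) * a = 4 * ((L : ℝ) - 1) * a := by rw [hRdef, ha'def]; push_cast; ring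
    have e2 : 0 ≤ 4 * ((L : ℝ) - 1) * a := mul_nonneg (mul_nonneg (by norm_num) (by linarith)) ha
    linarith
  have hDa : 2 * ((D : ℕ) : ℝ) * a ≤ θ := by
    have e1 : θ - 2 * ((D : ℕ) : ℝ) * a = 2 * ((d : ℝ) + 1) * L * a * (4 * (d + 4) * L - 1) := by
      rw [hθdef, hDdef]; push_cast; ring
    have e2 : 0 ≤ 2 * ((d : ℝ) + 1) * L * a * (4 * (d + 4) * L - 1) := mul_nonneg (by positivity) (by nlinarith)
    linarith
  have hθN : ((2 * (d * L) + L + L : ℕ) : ℝ) * a' ≤ θ := le_of_eq (by rw [ha'def, hθdef]; push_cast; ring)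
  have hl10 : l1 (q - q) = 0 := by simp [l1]
  have hRexp : R = 2 * (d * L) + 4 * L + 4 := by rw [hRdef]; ring
  have hDexp : D = d * L + L := by rw [hDdef]; ring
  -- the axial gauge of B5 (1.7) based at the corner `q`
  set u : Site d → 𝔸ˣ := axialFn V q with hu
  set V₀ : Site d → Fin d → 𝔸ˣ := gaugeAct u V with hV₀
  have huU : ∀ x, u x ∈ U1 𝔸 := fun x => axialFn_mem hV q x
  have hu1 : u q = 1 := by simp [hu, axialFn]
  have hV₀U : ∀ x μ, V₀ x μ ∈ U1 𝔸 := gaugeAct_mem hV huU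
  have hbond : ∀ x μ, ‖((V₀ x μ : 𝔸ˣ) : 𝔸) - 1‖ ≤ l1 (x - q) * a := fun x μ => axial_bond_bound V hV q h44 ha x μ
  have hb : ∀ x μ, l1 (x - q) ≤ R → ‖((V₀ x μ : 𝔸ˣ) : 𝔸) - 1‖ ≤ a' / 2 := fun x μ hx =>
    (hbond x μ).trans ((mul_le_mul_of_nonneg_right (by exact_mod_cast hx) ha).trans hRa)
  have hVA := bond_log q R ha'1 hb
  set A : Site d → Fin d → 𝔸 := fun x μ => mlog ((V₀ x μ : 𝔸ˣ) : 𝔸) with hAdef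
  -- (i) the loop variables: `log` versus the abelian contour sum
  have hloop := fun r : Fin d → Fin L =>
    loop_log_linear V₀ A q R ha' hVA L κ (by rw [hRexp]; omega) hθN hθ0 hθ1 r
  -- the gauge is trivial AT `q`: the loop variables and the exponent of `V₀` at `q` are those of `V`
  have hWcx : ∀ r : Site d, Wcx L V₀ q κ r = Wcx L V q κ r := by intro r; rw [hV₀, Wcx_gaugeAct, hu1]; simp
  have hXavg : Xavg L V₀ q κ = Xavg L V q κ := by unfold Xavg; simp_rw [hWcx]
  have hXn : ‖Xavg L V q κ‖ ≤ 4 * θ := by rw [← hXavg]; exact norm_avg_le L hL _ fun r => (hloop r).1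
  have hXXh : ‖Xavg L V q κ - Xhat L A q κ‖ ≤ 17 * θ ^ 2 := by
    rw [← hXavg, Xavg, Xhat, ← Finset.sum_sub_distrib]
    simp_rw [← smul_sub]
    exact norm_avg_le L hL _ fun r => (hloop r).2
  -- (ii) the plaquette variables, in both configurations
  have hplaq : ∀ (x : Site d) (m : Fin d), ‖((hol V x (plaqWord m κ) : 𝔸ˣ) : 𝔸) - 1‖ ≤ a := by
    intro x m
    by_cases hm : m = κ
    · rw [hm, hol_plaqWord_self]; simpa using ha
    · exact h44 x m κ hm
  have hplaq₀ : ∀ (x : Site d) (m : Fin d), ‖((hol V₀ x (plaqWord m κ) : 𝔸ˣ) : 𝔸) - 1‖ ≤ a := by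
    intro x m
    rw [hV₀, hol_plaqWord_gaugeAct, Units.val_mul, Units.val_mul]
    exact (norm_units_conj_sub_one_le (huU x) _).trans (hplaq x m)
  have hG₀ : ∀ (x : Site d) (m : Fin d), plaqLog V₀ κ m x = (u x : 𝔸) * plaqLog V κ m x * ((u x)⁻¹ : 𝔸ˣ) := by
    intro x m
    unfold plaqLog
    rw [hV₀, hol_plaqWord_gaugeAct, Units.val_mul, Units.val_mul]
    exact mlog_units_conj (huU x) ((hplaq x m).trans_lt (by linarith))
  have hG₀q : ∀ m : Fin d, plaqLog V₀ κ m q = plaqLog V κ m q := by intro m; rw [hG₀, hu1]; simp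
  have hG₀n : ∀ (x : Site d) (m : Fin d), ‖plaqLog V₀ κ m x‖ ≤ 2 * a := fun x m =>
    (MatrixLog.norm_mlog_le_two_mul ((hplaq₀ x m).trans hahalf)).trans (by linarith [hplaq₀ x m])
  -- (iii) the covariant gradient bound in the gauge, and the drift of the plaquette logarithm back to the corner
  have hgrad₀ : ∀ (x : Site d) (μ m : Fin d),
      ‖(V₀ x μ : 𝔸) * plaqLog V₀ κ m (x + e μ) * ((V₀ x μ)⁻¹ : 𝔸ˣ) - plaqLog V₀ κ m x‖ ≤ g := by
    intro x μ m
    have hid : (V₀ x μ : 𝔸) * plaqLog V₀ κ m (x + e μ) * ((V₀ x μ)⁻¹ : 𝔸ˣ) - plaqLog V₀ κ m x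
        = (u x : 𝔸) * ((V x μ : 𝔸) * plaqLog V κ m (x + e μ) * ((V x μ)⁻¹ : 𝔸ˣ) - plaqLog V κ m x)
            * ((u x)⁻¹ : 𝔸ˣ) := by
      rw [hG₀, hG₀, hV₀]
      simp only [gaugeAct, mul_inv_rev, inv_inv, Units.val_mul, mul_assoc, Units.inv_mul_cancel_left, mul_sub,
        sub_mul]
    rw [hid]
    exact (norm_units_conj_le (huU x) _).trans (hgrad x μ m)
  have hε0 : 0 ≤ g + 2 * (((D : ℕ) : ℝ) * a) * (2 * a) := by positivity
  have hstep : ∀ (m : Fin d) (p : Site d) (μ : Fin d), l1 (p - q) ≤ D → l1 (p + e μ - q) ≤ D →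
      ‖plaqLog V₀ κ m (p + e μ) - plaqLog V₀ κ m p‖ ≤ g + 2 * (((D : ℕ) : ℝ) * a) * (2 * a) :=
    fun m p μ hp _ => norm_step_le_of_covStep (hV₀U p μ) (hgrad₀ p μ m)
      ((hbond p μ).trans (mul_le_mul_of_nonneg_right (by exact_mod_cast hp) ha)) (hG₀n _ m)
  have hdrift : ∀ (x : Site d) (m : Fin d), l1 (x - q) ≤ D →
      ‖plaqLog V₀ κ m x - plaqLog V₀ κ m q‖ ≤ ((D : ℕ) : ℝ) * (g + 2 * (((D : ℕ) : ℝ) * a) * (2 * a)) := by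
    intro x m hx
    have h := norm_sub_le_of_steps (plaqLog V₀ κ m) q D hε0 (hstep m) (treeWord (x - q)) q
      (by rw [hl10, length_treeWord]; omega)
    rw [disp_treeWord, add_sub_cancel, length_treeWord] at h
    exact h.trans (mul_le_mul_of_nonneg_right (by exact_mod_cast hx) hε0)
  -- (iv) every swept plaquette functional is within `δ` of the plaquette logarithm AT THE CORNER
  obtain ⟨δ, hδdef⟩ :
      ∃ δ : ℝ, δ = 16 * a' ^ 2 + 4 * a ^ 2 + ((D : ℕ) : ℝ) * (g + 2 * (((D : ℕ) : ℝ) * a) * (2 * a)) := ⟨_, rfl⟩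
  have hδ0 : 0 ≤ δ := by rw [hδdef]; positivity
  have hΦ : ∀ (x : Site d) (m : Fin d), l1 (x - q) ≤ D → ‖asum A x (plaqWord m κ) - plaqLog V κ m q‖ ≤ δ := by
    intro x m hx
    have hlin := norm_asum_plaqWord_sub_plaqLog_le V₀ A q R ha' (by linarith) hVA κ m x
      (by rw [hRexp]; rw [hDexp] at hx; omega) (hplaq₀ x m) hahalf
    rw [← hG₀q, hδdef]
    calc _ = ‖(asum A x (plaqWord m κ) - plaqLog V₀ κ m x) + (plaqLog V₀ κ m x - plaqLog V₀ κ m q)‖ := by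
            rw [sub_add_sub_cancel]
      _ ≤ _ := norm_add_le _ _
      _ ≤ (16 * a' ^ 2 + 4 * a ^ 2) + ((D : ℕ) : ℝ) * (g + 2 * (((D : ℕ) : ℝ) * a) * (2 * a)) :=
            add_le_add hlin (hdrift x m hx)
  -- (v) the staircase sums against the first-moment main term
  have hstair : ∀ r : Fin d → Fin L,
      ‖stairSum A κ L (fun m => (r m : ℕ)) q (List.finRange d).reverse
          - stairMain L (fun m => (r m : ℕ)) (fun m => plaqLog V κ m q) (List.finRange d).reverse‖
        ≤ ((d * L : ℕ) : ℝ) * L * δ := by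
    intro r
    have htot : stepTotal (fun m => (r m : ℕ)) (List.finRange d).reverse ≤ d * L := by
      have h1 : stepTotal (fun m => (r m : ℕ)) (List.finRange d).reverse = ∑ m : Fin d, (r m : ℕ) := by
        rw [stepTotal, List.map_reverse, List.sum_reverse, Fin.sum_univ_def]
      rw [h1]
      calc ∑ m : Fin d, (r m : ℕ) ≤ ∑ _m : Fin d, L := Finset.sum_le_sum fun m _ => (r m).isLt.le
        _ = d * L := by simp
    have h := norm_stairSum_sub_stairMain_le A κ L (fun m => (r m : ℕ)) (fun m => plaqLog V κ m q) q D hδ0 hΦ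
      (List.finRange d).reverse q (by rw [hl10, hDexp]; omega)
    exact h.trans (mul_le_mul_of_nonneg_right (mul_le_mul_of_nonneg_right (by exact_mod_cast htot)
      (by positivity)) hδ0)
  -- (vi) the block average: the contour sums are staircase sums, the main terms average to `X¹_c`
  have hXhat : Xhat L A q κ = ∑ r : Fin d → Fin L,
      ((L : ℝ) ^ d)⁻¹ • stairSum A κ L (fun m => (r m : ℕ)) q (List.finRange d).reverse := by
    unfold Xhat
    exact Finset.sum_congr rfl fun r _ => by rw [asum_loop_eq_stairSum]
  have hmain : ∑ r : Fin d → Fin L, ((L : ℝ) ^ d)⁻¹ •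
      stairMain L (fun m => (r m : ℕ)) (fun m => plaqLog V κ m q) (List.finRange d).reverse = Xfirst L V q κ :=
    avg_stairMain_eq L hL _
  have hXhXf : ‖Xhat L A q κ - Xfirst L V q κ‖ ≤ ((d * L : ℕ) : ℝ) * L * δ := by
    rw [hXhat, ← hmain, ← Finset.sum_sub_distrib]
    simp_rw [← smul_sub]
    exact norm_avg_le L hL _ hstair
  -- (vii) numerics
  have hnum : 17 * θ ^ 2 + ((d * L : ℕ) : ℝ) * L * δ
      ≤ 20 * d * (L : ℝ) ^ 2 * θ ^ 2 + d * (d + 1) * (L : ℝ) ^ 3 * g := by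
    have h1 : 16 * a' ^ 2 ≤ θ ^ 2 := by
      rw [show 16 * a' ^ 2 = (4 * a') ^ 2 by ring]; exact pow_le_pow_left₀ (by positivity) haθ 2
    have h2 : 4 * a ^ 2 ≤ θ ^ 2 := by
      rw [show 4 * a ^ 2 = (2 * a) ^ 2 by ring]; exact pow_le_pow_left₀ (by positivity) ha2 2
    have h3 : ((D : ℕ) : ℝ) * (2 * (((D : ℕ) : ℝ) * a) * (2 * a)) ≤ θ ^ 2 := by
      have : ((D : ℕ) : ℝ) * (2 * (((D : ℕ) : ℝ) * a) * (2 * a)) = (2 * ((D : ℕ) : ℝ) * a) ^ 2 := by ring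
      rw [this]; exact pow_le_pow_left₀ (by positivity) hDa 2
    have hδ : δ ≤ 3 * θ ^ 2 + ((D : ℕ) : ℝ) * g := by
      rw [hδdef, mul_add]; linarith only [h1, h2, h3]
    have hdL : (1 : ℝ) ≤ d * (L : ℝ) ^ 2 := one_le_mul_of_one_le_of_one_le hdr (one_le_pow₀ hLr)
    have h4 : ((d * L : ℕ) : ℝ) * L * δ ≤ ((d * L : ℕ) : ℝ) * L * (3 * θ ^ 2 + ((D : ℕ) : ℝ) * g) :=
      mul_le_mul_of_nonneg_left hδ (by positivity)
    have h5 : ((d * L : ℕ) : ℝ) * L * (3 * θ ^ 2 + ((D : ℕ) : ℝ) * g)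
        = 3 * (d * (L : ℝ) ^ 2) * θ ^ 2 + d * (d + 1) * (L : ℝ) ^ 3 * g := by
      rw [hDdef]; push_cast; ring
    have h6 : 17 * θ ^ 2 ≤ 17 * (d * (L : ℝ) ^ 2) * θ ^ 2 :=
      mul_le_mul_of_nonneg_right (by linarith only [hdL]) (sq_nonneg θ)
    linarith only [h4, h5, h6]
  refine ⟨?_, hXn⟩
  calc ‖Xavg L V q κ - Xfirst L V q κ‖
      = ‖(Xavg L V q κ - Xhat L A q κ) + (Xhat L A q κ - Xfirst L V q κ)‖ := by rw [sub_add_sub_cancel]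
    _ ≤ _ := norm_add_le _ _
    _ ≤ 17 * θ ^ 2 + ((d * L : ℕ) : ℝ) * L * δ := add_le_add hXXh hXhXf
    _ ≤ _ := hnum

end Core

end

end Summit.QuantumFields.BalabanUV.T4Continuum.BlockAverageLoopLogCore
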